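import Mathlib
import Summits.NavierStokesRegularity.NavierStokesRegularity.Theorems.EulerZoomLiouvillePowerGaugeEulerLiouvilleCasimirFloorMember
import Summits.NavierStokesRegularity.NavierStokesRegularity.Theorems.EulerZoomLiouvillePowerGaugeEulerLiouvilleSwirlCapacityAxisFloor
import Summits.NavierStokesRegularity.NavierStokesRegularity.Theorems.EulerZoomLiouvillePowerGaugeEulerLiouvilleSwirlCapacityEndgameDoors
import Summits.NavierStokesRegularity.NavierStokesRegularity.Theorems.EulerZoomLiouvillePowerGaugeEulerLiouvilleSwirlCapacityTransport
import HarnessLib.Audit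

/-!
# Crux E `PowerGaugeEulerLiouville` (stmt-NavierStokesRegularity-19832): ALL classical AXISYMMETRIC members with drift exponent
# `κ ∈ ((1−ρ)/(2−ρ), 1)` are trivial — the union of the lines `casimir-floor` (swirl-free) and `swirl-capacity` (swirling) in ONE predicate

Route `EulerZoomLiouville` (NavierStokesRegularity), crux E.  The two sibling lines of ideator ns-idea-11 g3 have landed:
* `casimir-floor` (LINE A; K1–K3 + member theorem `CasimirFloor.ae_eq_zero_of_gauge_of_swirlFreeSlowDrifting`, width seat ns-cas-k2): classical
  axisymmetric SWIRL-FREE members with `‖u(τ)‖_∞ ≤ M(−τ)^{−κ}`, `κ > (1−ρ)/(2−ρ)`, vanish;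
* `swirl-capacity` (LINE D; D1 ns-sfl-p1 `swirlBlobsPersist_of_axiDriftingWith`, D2_pow ns-cas-k2 `axisCapacityFloorPow`, D2′_pow/D3_pow ns-ezl-w2
  `swirlEndgamePow`): classical axisymmetric members WITH swirl somewhere, `0 ≤ M`, `(1−ρ)/(2−ρ) < κ < 1`, cannot exist (vanish).
Their union is a single stratum with no swirl clause at all, which is what this file records for the lead skeleton (`Lines/birth.lean`, interim
LEAD ns-typeII-p2 g10): **`AxisymSlowDrifting.ae_eq_zero_of_gauge_of_axisymSlowDrifting`** — crux hypotheses verbatim (`0 < ρ ≤ ½`) + `(u, p)` classical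
Euler on `(−∞, 0)` with axisymmetric velocity AND pressure slices + a drift bound `‖u(τ, x)‖ ≤ M (−τ)^{−κ}`, `0 ≤ M`, `(1−ρ)/(2−ρ) < κ < 1` ⇒ `u = 0` a.e.
(case split on `∃ τ₀ < 0, ∃ x, swirl (u τ₀) x ≠ 0`).  The swirl-free half alone needs neither `κ < 1` nor the pressure symmetry
(`CasimirFloor.ae_eq_zero_of_gauge_of_swirlFreeSlowDrifting`); both are used only through the swirling half.

WHAT THIS IS NOT: not NS regularity, not the crux E — a stratum statement about a hypothetical Euler zoom-limit class («slow-drifting classical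
axisymmetric members do not exist»); the residues (fast drift `κ ≤ (1−ρ)/(2−ρ)`, `κ ≥ 1` with swirl, non-axisymmetric / non-classical members) stay
OPEN in the lead skeleton; nothing here bears on NS regularity itself.  `--supports stmt-NavierStokesRegularity-19832 --as helper`. [folklore]
-/

noncomputable section

set_option linter.dupNamespace false

open MeasureTheory Set Filter Topology Metric Function
open scoped NNReal ENNReal

namespace Summit.NavierStokesRegularity.NavierStokesRegularity.Theorems.PowerGaugeEulerLiouville.AxisymSlowDrifting

open Literature.Analysis Literature.Analysis.FluidPDE
open Summit.NavierStokesRegularity.NavierStokesRegularity.Theorems.PowerGaugeEulerLiouville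

variable {u : ℝ → EuclideanSpace ℝ (Fin 3) → EuclideanSpace ℝ (Fin 3)} {p : ℝ → EuclideanSpace ℝ (Fin 3) → ℝ}
  {H : ℝ → EuclideanSpace ℝ (Fin 3) → EuclideanSpace ℝ (Fin 3) →L[ℝ] EuclideanSpace ℝ (Fin 3)} {c : ℝ≥0}

/-- **CLASSICAL AXISYMMETRIC MEMBERS WITH DRIFT EXPONENT `κ ∈ ((1−ρ)/(2−ρ), 1)` ARE TRIVIAL** (swirl or no swirl).  Crux hypotheses verbatim
(`0 < ρ ≤ ½`, suitable weak Euler on the past slab, weak gradient `H`, power gauges `≤ c`) + classical Euler on `(−∞,0)` with axisymmetric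
velocity and pressure slices + `‖u(τ, x)‖ ≤ M (−τ)^{−κ}` for `τ < 0` with `0 ≤ M`, `(1−ρ)/(2−ρ) < κ < 1` ⇒ `u = 0` a.e. on `(−∞,0) × ℝ³`.
Proof: if some past slice carries swirl, line `swirl-capacity` (`SwirlCapacity.swirlEndgamePow` with the proved power floor
`SwirlCapacity.axisCapacityFloorPow` and the transport `SwirlCapacity.swirlBlobsPersist_of_axiDriftingWith`); otherwise every past slice is swirl-free
and line `casimir-floor` applies (`CasimirFloor.ae_eq_zero_of_gauge_of_swirlFreeSlowDrifting`). [folklore] -/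
theorem ae_eq_zero_of_gauge_of_axisymSlowDrifting {ρ : ℝ} (hρ : 0 < ρ) (hρh : ρ ≤ 1 / 2)
    (hsw : IsSuitableWeakSolutionOn (slab (EuclideanSpace ℝ (Fin 3)) (Iio 0) isOpen_Iio) 0 0 u p)
    (hH : HasWeakSpatialGradientOn (slab (EuclideanSpace ℝ (Fin 3)) (Iio 0) isOpen_Iio) u H)
    (hgauge : ∀ a : ℝ, 0 < a →
      ENNReal.ofReal (a ^ (2 * ρ)) * cknA a (0 : ℝ × EuclideanSpace ℝ (Fin 3)) u +
          ENNReal.ofReal (a ^ ρ) * cknE a (0 : ℝ × EuclideanSpace ℝ (Fin 3)) H +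
        ENNReal.ofReal (a ^ (2 * ρ)) * cknD a (0 : ℝ × EuclideanSpace ℝ (Fin 3)) p ≤ (c : ℝ≥0∞))
    (hcl : IsClassicalEulerSolutionOn (Iio 0) 0 u p)
    (hsym : ∀ τ : ℝ, τ < 0 → IsAxisymmetric (u τ) ∧ IsAxisymmetricScalar (p τ))
    {M κ : ℝ} (hM0 : 0 ≤ M) (hκρ : (1 - ρ) / (2 - ρ) < κ) (hκ1 : κ < 1)
    (hM : ∀ τ : ℝ, τ < 0 → ∀ x : EuclideanSpace ℝ (Fin 3), ‖u τ x‖ ≤ M * (-τ) ^ (-κ)) :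
    uncurry u =ᵐ[volume.restrict (Iio (0 : ℝ) ×ˢ (univ : Set (EuclideanSpace ℝ (Fin 3))))] 0 := by
  by_cases hswirl : ∃ τ₀ : ℝ, τ₀ < 0 ∧ ∃ x : EuclideanSpace ℝ (Fin 3), swirl (u τ₀) x ≠ 0
  · -- the swirling half: line `swirl-capacity`
    exact SwirlCapacity.swirlEndgamePow SwirlCapacity.axisCapacityFloorPow ρ hρ hρh u p H c ⟨hsw, hH, hgauge⟩ M κ hκρ
      ⟨hcl, hsym, hM0, hκ1, hM⟩ hswirl (SwirlCapacity.swirlBlobsPersist_of_axiDriftingWith u p M κ ⟨hcl, hsym, hM0, hκ1, hM⟩)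
  · -- the swirl-free half: line `casimir-floor`
    push Not at hswirl
    have hsym' : ∀ τ : ℝ, τ < 0 → IsAxisymmetric (u τ) ∧ HasNoSwirl (u τ) :=
      fun τ hτ => ⟨(hsym τ hτ).1, fun x => hswirl τ hτ x⟩
    exact CasimirFloor.ae_eq_zero_of_gauge_of_swirlFreeSlowDrifting hρ hρh hsw hH hgauge hcl hsym' hκρ hM

/-- The same, packaged with the existential drift data: classical axisymmetric (velocity and pressure) member + `∃ M κ, 0 ≤ M ∧ (1−ρ)/(2−ρ) < κ ∧
κ < 1 ∧ ‖u(τ,x)‖ ≤ M(−τ)^{−κ}` ⇒ trivial — the shape of a skeleton predicate `IsAxisymSlowDrifting ρ u p`. [folklore] -/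
theorem ae_eq_zero_of_gauge_of_axisymSlowDrifting' {ρ : ℝ} (hρ : 0 < ρ) (hρh : ρ ≤ 1 / 2)
    (hsw : IsSuitableWeakSolutionOn (slab (EuclideanSpace ℝ (Fin 3)) (Iio 0) isOpen_Iio) 0 0 u p)
    (hH : HasWeakSpatialGradientOn (slab (EuclideanSpace ℝ (Fin 3)) (Iio 0) isOpen_Iio) u H)
    (hgauge : ∀ a : ℝ, 0 < a →
      ENNReal.ofReal (a ^ (2 * ρ)) * cknA a (0 : ℝ × EuclideanSpace ℝ (Fin 3)) u +
          ENNReal.ofReal (a ^ ρ) * cknE a (0 : ℝ × EuclideanSpace ℝ (Fin 3)) H +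
        ENNReal.ofReal (a ^ (2 * ρ)) * cknD a (0 : ℝ × EuclideanSpace ℝ (Fin 3)) p ≤ (c : ℝ≥0∞))
    (hstr : IsClassicalEulerSolutionOn (Iio 0) 0 u p ∧
      (∀ τ : ℝ, τ < 0 → IsAxisymmetric (u τ) ∧ IsAxisymmetricScalar (p τ)) ∧
      ∃ M κ : ℝ, 0 ≤ M ∧ (1 - ρ) / (2 - ρ) < κ ∧ κ < 1 ∧
        ∀ τ : ℝ, τ < 0 → ∀ x : EuclideanSpace ℝ (Fin 3), ‖u τ x‖ ≤ M * (-τ) ^ (-κ)) :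
    uncurry u =ᵐ[volume.restrict (Iio (0 : ℝ) ×ˢ (univ : Set (EuclideanSpace ℝ (Fin 3))))] 0 := by
  obtain ⟨hcl, hsym, M, κ, hM0, hκρ, hκ1, hM⟩ := hstr
  exact ae_eq_zero_of_gauge_of_axisymSlowDrifting hρ hρh hsw hH hgauge hcl hsym hM0 hκρ hκ1 hM

end Summit.NavierStokesRegularity.NavierStokesRegularity.Theorems.PowerGaugeEulerLiouville.AxisymSlowDrifting

end
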